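import Mathlib.LinearAlgebra.FiniteDimensional.Lemmas
import Mathlib.RingTheory.Flat.Basic
import Literature.AlgebraicGeometry.Motives.ComparisonAbsolute
import HarnessLib

/-!
# Discharges of `sum_hodgeNumber_eq_finrank` and `hodgeNumber_dR_eq_hodgeNumber_betti` (hodge.S18)

This file proves two named facts of `ComparisonAbsolute.lean` about a period realization
`P : PeriodRealization k` over a field `k` of characteristic zero, `X` smooth projective over `k`
and `σ : k →+* ℂ`:

* Part 1, `sum_hodgeNumber_eq_finrank_holds`: `∑_{p=0}^{i} h^{p,i-p}(X) = dim_ℚ Hⁱ((σX)(ℂ), ℚ)`;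
* Part 2, `hodgeNumber_dR_eq_hodgeNumber_betti_holds`: `h^{p,q}(X) = h^{p,q}(Hⁱ((σX)(ℂ), ℚ))`, the
  Hodge numbers of the algebraic Hodge filtration are those of the Betti Hodge structure.

## Part 1. Discharge of `sum_hodgeNumber_eq_finrank` (hodge.S18, `E₁`-degeneration clause)

This part proves the named fact `Literature.AlgebraicGeometry.Motives.sum_hodgeNumber_eq_finrank`
of `ComparisonAbsolute.lean`: for a period realization `P : PeriodRealization k`, `X` smooth
projective over `k` and `σ : k →+* ℂ`,
`∑_{p=0}^{i} h^{p,i-p}(X) = dim_ℚ Hⁱ((σX)(ℂ), ℚ)`.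

### The source

Deligne–Illusie, *Relèvements modulo `p²` et décomposition du complexe de de Rham*, Invent.
Math. 89 (1987), Cor. 2.7 (p. 257): for `K` a field of characteristic `0` and `X` a proper smooth
`K`-scheme, the Hodge-to-de Rham spectral sequence `E₁^{ij} = H^j(X, Ωⁱ) ⇒ H_DR^*(X/K)`
degenerates at `E₁`; equivalently (loc. cit., formula (∗), p. 257) `∑_{i+j=n} h^{ij} = hⁿ` with
`h^{ij} = dim H^j(X, Ωⁱ)` and `hⁿ = dim Hⁿ_DR(X/K)`. (Cor. 2.4, p. 255, is the characteristic-`p`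
statement for `X` proper smooth of dimension `≤ p` liftable to `W₂(k)`, from which 2.7 is deduced
by spreading out.) Combined with Grothendieck's comparison theorem
`dim_k Hⁱ_dR(X/k) = dim_ℚ Hⁱ((σX)(ℂ), ℚ)` (Grothendieck 1966, Thm. 1') this is the statement of
the fact.

### The proof here

In the hypothesis structure `DeRhamRealization` the Hodge numbers are *defined* as
`h^{p,q} = dim_k gr_F^p H^{p+q}_dR` (Deligne, *Théorie de Hodge II*, 2.3.7), so `E₁`-degeneration
is built into the bookkeeping and the fact is a formal consequence of two results already proved
in the tree:

* `DeRhamRealization.sum_hodgeNumber_holds`: `∑_{p=0}^{i} h^{p,i-p}(X) = dim_k Hⁱ_dR(X/k)`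
  (telescoping `finrank` along the finite filtration `Hⁱ = F⁰ ⊇ F¹ ⊇ ⋯ ⊇ F^{i+1} = 0`);
* `finrank_dR_eq_finrank_betti`: `dim_k Hⁱ_dR(X/k) = dim_ℚ Hⁱ((σX)(ℂ), ℚ)` (both ends of the
  comparison isomorphism `P.isoEquiv`).

This is exactly the interim proof preserved in a comment under the fact in
`ComparisonAbsolute.lean` (D-0014 sorry-sweep), now closed.

## Part 2. Discharge of `hodgeNumber_dR_eq_hodgeNumber_betti` (hodge.S18, Hodge numbers)

This part proves the named fact `Literature.AlgebraicGeometry.Motives.hodgeNumber_dR_eq_hodgeNumber_betti`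
(**hodge.S18**, file `ComparisonAbsolute`): for a period realization `P` over a field `k` of
characteristic zero, `X` smooth projective over `k`, `σ : k →+* ℂ` and the Hodge structure
`H = P.B.hodge hXσ i` of weight `i` on `V = Hⁱ((σX)(ℂ), ℚ)`,
`h^{p,q}(X) := dim_k gr_F^p H^{p+q}_dR(X/k)` equals `h^{p,q}(H) := dim_ℂ H^{p,q}`,
`H^{p,q} = Fᵖ ∩ conj F^q`.

### Proof

The statement is a formal consequence of the fields of `PeriodRealization` (the comparison
isomorphism `iso` and its compatibility `iso_fil` with the Hodge filtrations) and of the axioms of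
`HodgeStructure` (opposedness). The mathematics packaged in those fields is Grothendieck's
comparison theorem `Hⁱ_dR(X/k) ⊗_{k,σ} ℂ ≅ Hⁱ(X_σ(ℂ), ℚ) ⊗ ℂ` (Grothendieck 1966, Thm. 1'), the fact
that it carries the algebraic Hodge filtration onto the analytic one (GAGA; Deligne, *Théorie de
Hodge II*, 2.2 and 3.2), and Deligne's dictionary between `n`-opposed filtrations and bigradings
(Hodge II, Prop. 1.2.5: `F^p = ⊕_{p' ≥ p} V^{p',q'}`, so `Gr_F^p V_ℂ = V^{p,q}`). Formally:

1. `dim_k Fᵖ Hⁱ_dR = dim_L (Fᵖ Hⁱ_dR ⊗_k L)` for `L = ℂ` regarded as a `k`-algebra via `σ`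
   (flat base change, `finrank_submodule_baseChange`) `= dim_L iso(Fᵖ ⊗ L)` (`iso` is injective on
   smooth projective `X`) `= dim_ℂ Fᵖ H` (`iso_fil`; the identification
   `alongHomTensorEquiv : L ⊗_ℚ V ≃ ℂ ⊗_ℚ V` is semilinear over `AlongHom.equiv σ : L ≃+* ℂ`, and
   ranks are invariant under semilinear bijections, Mathlib `rank_eq_of_equiv_equiv`). This is
   `PeriodRealization.finrank_fil_eq_finrank_F`.
2. On the de Rham side `dim gr_F^p + dim F^{p+1} = dim Fᵖ` (`finrank_gradedPiece_add_finrank`).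
3. On the Betti side, for `p + q = i`: `F^{p+1} ⊕ conj F^q = V_ℂ` (opposedness with
   `(p+1) + q = i + 1`) and `F^{p+1} ⊆ Fᵖ` give, by the modular law,
   `Fᵖ = F^{p+1} ⊕ (Fᵖ ∩ conj F^q) = F^{p+1} ⊕ H^{p,q}`, whence `dim Fᵖ = dim F^{p+1} + h^{p,q}(H)`
   (`HodgeStructure.finrank_F_eq_finrank_F_add_one_add_hodgeNumber`; Deligne, Hodge II, 1.2.5;
   Voisin, *Hodge Theory I*, §7.1.1).

Comparing 2 and 3 through 1 (at `p` and `p + 1`) gives the claim; off the line `p + q = i` both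
sides vanish by definition. Finite-dimensionality comes from `WeilCohomology.finite_obj` on both
sides.

## References

* P. Deligne, L. Illusie, *Relèvements modulo p² et décomposition du complexe de de Rham*,
  Invent. Math. 89 (1987), 247–270, Cor. 2.4, Cor. 2.7.
* P. Deligne, *Théorie de Hodge II*, Publ. IHÉS 40 (1971), Prop. 1.2.5, §2.2, 2.3.7, §3.2.
* A. Grothendieck, *On the de Rham cohomology of algebraic varieties*, Publ. IHÉS 29 (1966),
  Thm. 1'.
* C. Voisin, *Hodge Theory and Complex Algebraic Geometry I* (2002), §7.1.1.
-/

open CategoryTheory AlgebraicGeometry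

noncomputable section

namespace Literature.AlgebraicGeometry.Motives

variable {k : Type} [Field k] [CharZero k] (P : PeriodRealization k) {n : ℕ} {X : SchemeOver k}

/-- **Discharge of `sum_hodgeNumber_eq_finrank`** (hodge.S18, Hodge-to-de Rham degeneration at
`E₁`, numerical form `∑_{i+j=n} h^{ij} = hⁿ`: Deligne–Illusie, Invent. Math. 89 (1987), Cor. 2.7
and formula (∗), p. 257; Deligne, *Théorie de Hodge II*, 2.3.7). For `X` smooth projective over
`k` and `σ : k →+* ℂ`, `∑_{p=0}^{i} h^{p,i-p}(X) = dim_ℚ Hⁱ((σX)(ℂ), ℚ)`: rewrite the left-hand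
side as `dim_k Hⁱ_dR(X/k)` by `DeRhamRealization.sum_hodgeNumber_holds` (telescoping `finrank`
along `Hⁱ = F⁰ ⊇ ⋯ ⊇ F^{i+1} = 0`) and conclude by the numerical comparison theorem
`finrank_dR_eq_finrank_betti`. Depends only on: `finite_obj`, `antitone_fil`, `fil_nonpos`,
`fil_eq_bot` (through `sum_hodgeNumber_holds`) and `isoInv_iso`, `iso_isoInv` (through
`finrank_dR_eq_finrank_betti`). [cite: DeligneIllusie1987, Cor. 2.7] -/
theorem sum_hodgeNumber_eq_finrank_holds : sum_hodgeNumber_eq_finrank P (n := n) (X := X) := by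
  intro σ hX i
  rw [P.dR.sum_hodgeNumber_holds hX i, DeRhamRealization.bettiNumber,
    finrank_dR_eq_finrank_betti P σ hX i]

end Literature.AlgebraicGeometry.Motives

/-! ## Part 2. Hodge numbers of the algebraic Hodge filtration versus those of the Betti Hodge structure -/

open Opposite
open scoped TensorProduct

namespace Literature.AlgebraicGeometry.Motives

universe u v

/-! ### Linear algebra -/

section LinearAlgebra

/-- `finrank` is invariant under semilinear bijections over a ring isomorphism: if `j : M ≃+ M'`
satisfies `j (r • m) = i r • j m` for a ring isomorphism `i : R ≃+* R'`, then
`finrank R M = finrank R' M'` (the `finrank` form of Mathlib's `rank_eq_of_equiv_equiv`). [folklore] -/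
theorem finrank_eq_of_addEquiv_semilinear {R : Type*} {R' : Type*} [Semiring R] [Semiring R']
    {M M' : Type v} [AddCommMonoid M] [Module R M] [AddCommMonoid M'] [Module R' M']
    (i : R ≃+* R') (j : M ≃+ M') (hc : ∀ (r : R) (m : M), j (r • m) = i r • j m) :
    Module.finrank R M = Module.finrank R' M' := by
  unfold Module.finrank
  rw [rank_eq_of_equiv_equiv i j i.bijective hc]

/-- Base change to a field extension preserves the dimension of a subspace:
`dim_{A'} (p ⊗_A A') = dim_A p` for a subspace `p ⊆ M` over a field `A` and a field `A' ⊇ A`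
(`A'` is flat over `A`, so `p ⊗_A A' → M ⊗_A A'` is injective; Bourbaki, *Algèbre* II, §7, no. 7). [folklore] -/
theorem finrank_submodule_baseChange {A : Type*} [Field A] (A' : Type*) [Field A'] [Algebra A A']
    {M : Type*} [AddCommGroup M] [Module A M] (p : Submodule A M) :
    Module.finrank A' ↥(p.baseChange A') = Module.finrank A ↥p := by
  have hinj : Function.Injective (p.subtype.baseChange A') :=
    Module.Flat.lTensor_preserves_injective_linearMap (M := A') p.subtype p.injective_subtype
  rw [Submodule.baseChange, LinearMap.finrank_range_of_inj hinj, Module.finrank_baseChange]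

/-- Modular-law dimension count: in a finite-dimensional space, if `A ⊆ C` and `A ⊕ B = V`
(`IsCompl A B`), then `C = A ⊕ (C ∩ B)`, so `dim C = dim A + dim (C ∩ B)`. [folklore] -/
theorem finrank_eq_finrank_add_finrank_inf_of_isCompl {K : Type*} [DivisionRing K] {V : Type*}
    [AddCommGroup V] [Module K V] [FiniteDimensional K V] {A B C : Submodule K V} (hAC : A ≤ C)
    (hAB : IsCompl A B) :
    Module.finrank K ↥C = Module.finrank K ↥A + Module.finrank K ↥(C ⊓ B) := by
  have hsup : C ⊓ B ⊔ A = C := by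
    rw [inf_sup_assoc_of_le B hAC, hAB.symm.sup_eq_top, inf_top_eq]
  have hinf : C ⊓ B ⊓ A = ⊥ :=
    eq_bot_iff.2 ((inf_le_inf_right A inf_le_right).trans hAB.symm.inf_eq_bot.le)
  have key := Submodule.finrank_sup_add_finrank_inf_eq (C ⊓ B) A
  rw [hsup, hinf, finrank_bot, add_zero] at key
  rw [key, add_comm]

/-- `alongHomTensorEquiv σ V : AlongHom ℂ σ ⊗_ℚ V ≃ ℂ ⊗_ℚ V` is semilinear over the identity ring
isomorphism `AlongHom.equiv σ : AlongHom ℂ σ ≃+* ℂ`: it carries the `AlongHom ℂ σ`-action (on the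
left factor) to the `ℂ`-action. [folklore] -/
theorem alongHomTensorEquiv_smul {k : Type*} [CommRing k] (σ : k →+* ℂ) {V : Type*}
    [AddCommGroup V] [Module ℚ V] (c : AlongHom ℂ σ) (x : AlongHom ℂ σ ⊗[ℚ] V) :
    alongHomTensorEquiv σ V (c • x) = AlongHom.equiv σ c • alongHomTensorEquiv σ V x := by
  induction x using TensorProduct.induction_on with
  | zero => rw [smul_zero, map_zero, smul_zero]
  | tmul a v =>
      rw [TensorProduct.smul_tmul', alongHomTensorEquiv_tmul, alongHomTensorEquiv_tmul,
        TensorProduct.smul_tmul', smul_eq_mul, smul_eq_mul, map_mul]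
  | add x y hx hy => rw [smul_add, map_add, hx, hy, map_add, smul_add]

end LinearAlgebra

/-! ### Hodge structures: `dim Fᵖ = dim F^{p+1} + h^{p,q}` -/

namespace HodgeStructure

variable {V : Type u} [AddCommGroup V] [Module ℚ V] {n : ℤ}

/-- For a pure Hodge structure of weight `n` on a `ℚ`-vector space `V` with `V_ℂ` finite-dimensional
and `p + q = n`: `dim_ℂ Fᵖ = dim_ℂ F^{p+1} + h^{p,q}`. Indeed `F^{p+1} ⊕ conj F^q = V_ℂ`
(opposedness, `(p+1) + q = n + 1`) and `F^{p+1} ⊆ Fᵖ`, so by the modular law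
`Fᵖ = F^{p+1} ⊕ (Fᵖ ∩ conj F^q) = F^{p+1} ⊕ V^{p,q}` (Deligne, *Théorie de Hodge II*, Prop. 1.2.5:
`Fᵖ = ⊕_{p' ≥ p} V^{p', n-p'}`, `Gr_F^p = V^{p,q}`; Voisin, *Hodge Theory I*, §7.1.1). [cite: DeligneHodgeII1971, Prop. 1.2.5] -/
theorem finrank_F_eq_finrank_F_add_one_add_hodgeNumber [FiniteDimensional ℂ (ℂ ⊗[ℚ] V)]
    (H : HodgeStructure V n) {p q : ℤ} (hpq : p + q = n) :
    Module.finrank ℂ ↥(H.F p) = Module.finrank ℂ ↥(H.F (p + 1)) + H.hodgeNumber p q := by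
  rw [hodgeNumber, piece_of_add_eq H hpq]
  exact finrank_eq_finrank_add_finrank_inf_of_isCompl (H.antitone_F (le_add_of_nonneg_right zero_le_one))
    (H.isCompl_F_complexConj (p + 1) q (by omega))

end HodgeStructure

/-! ### The comparison of Hodge numbers -/

namespace PeriodRealization

variable {k : Type} [Field k] [CharZero k] (P : PeriodRealization k) {n : ℕ} {X : SchemeOver k}

/-- **Dimensions of the Hodge filtrations agree under the comparison.** For `X` smooth projective
over `k`, `σ : k →+* ℂ` and every `p`, `dim_k Fᵖ Hⁱ_dR(X/k) = dim_ℂ Fᵖ (Hⁱ(X_σ(ℂ), ℚ) ⊗ ℂ)`: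
`dim_k Fᵖ = dim_L (Fᵖ ⊗_{k,σ} L)` (`L = ℂ` via `σ`, flat over `k`) `= dim_L iso(Fᵖ ⊗ L)` (`iso`
injective, Grothendieck 1966, Thm. 1') `= dim_ℂ Fᵖ H` (`iso_fil`: the comparison carries the
algebraic Hodge filtration onto that of the Hodge structure; the identification
`L ⊗_ℚ V ≃ ℂ ⊗_ℚ V` is semilinear over `AlongHom.equiv σ`, and ranks are invariant under semilinear
bijections). [cite: Grothendieck1966, Thm. 1'] -/
theorem finrank_fil_eq_finrank_F (σ : k →+* ℂ) (hX : IsSmoothProjective n X)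
    (hXσ : IsSmoothProjective n ((baseChangeHom σ).obj X)) (i : ℕ) (p : ℤ) :
    Module.finrank k ↥(P.dR.fil (X := X) i p) =
      Module.finrank ℂ ↥((P.B.hodge hXσ i).F p) := by
  have h1 : Module.finrank k ↥(P.dR.fil (X := X) i p) =
      Module.finrank (AlongHom ℂ σ) ↥((P.dR.fil (X := X) i p).baseChange (AlongHom ℂ σ)) :=
    (finrank_submodule_baseChange (AlongHom ℂ σ) _).symm
  have h2 : Module.finrank (AlongHom ℂ σ) ↥((P.dR.fil (X := X) i p).baseChange (AlongHom ℂ σ)) =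
      Module.finrank (AlongHom ℂ σ)
        ↥(((P.dR.fil (X := X) i p).baseChange (AlongHom ℂ σ)).map (P.iso σ X i)) :=
    (Submodule.equivMapOfInjective (P.iso σ X i) (P.bijective_iso σ hX i).1 _).finrank_eq
  rw [h1, h2]
  -- the semilinear identification of `iso (Fᵖ ⊗ L)` with `Fᵖ H` given by `iso_fil`
  have hfil := P.iso_fil σ hX hXσ i p
  let j : ↥(((P.dR.fil (X := X) i p).baseChange (AlongHom ℂ σ)).map (P.iso σ X i)) ≃+
      ↥((P.B.hodge hXσ i).F p) :=
    ((alongHomTensorEquiv σ ((P.B.comap σ).obj X i)).ofSubmodules _ _ hfil).toAddEquiv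
  refine finrank_eq_of_addEquiv_semilinear (AlongHom.equiv σ) j fun r m ↦ Subtype.ext ?_
  exact alongHomTensorEquiv_smul σ r (m : AlongHom ℂ σ ⊗[ℚ] (P.B.comap σ).obj X i)

end PeriodRealization

section Hodge

variable {k : Type} [Field k] [CharZero k] (P : PeriodRealization k) {n : ℕ} {X : SchemeOver k}

/-- **Discharge of `hodgeNumber_dR_eq_hodgeNumber_betti` (hodge.S18).** For `X` smooth projective
over `k`, `σ : k →+* ℂ`, and all `i`, `p`, `q`: the Hodge number
`h^{p,q}(X) = dim_k gr_F^p H^{p+q}_dR(X/k)` of the algebraic Hodge filtration equals the Hodge number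
`dim_ℂ H^{p,q}` of the pure Hodge structure on `Hⁱ((σX)(ℂ), ℚ)` (Grothendieck 1966, Thm. 1', with
GAGA and Deligne, Hodge II, 2.2, 3.2 for the filtrations — packaged in `iso_fil` — and Hodge II,
Prop. 1.2.5 for `Gr_F^p = H^{p,q}`). Proof: `dim gr_F^p = dim Fᵖ_dR - dim F^{p+1}_dR`
(`finrank_gradedPiece_add_finrank`), both terms agree with the Betti side
(`PeriodRealization.finrank_fil_eq_finrank_F`), and there `dim Fᵖ - dim F^{p+1} = h^{p,q}`
(`HodgeStructure.finrank_F_eq_finrank_F_add_one_add_hodgeNumber`); off the line `p + q = i` both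
sides are `0` by definition. [cite: Grothendieck1966, Thm. 1'] -/
theorem hodgeNumber_dR_eq_hodgeNumber_betti_holds :
    hodgeNumber_dR_eq_hodgeNumber_betti P (n := n) (X := X) := by
  intro σ hX hXσ i p q
  by_cases hpq : p + q = i
  · haveI : Module.Finite k (P.dR.obj X i) := P.dR.finite_obj hX i
    haveI : Module.Finite ℚ (P.B.W.obj ((baseChangeHom σ).obj X) i) := P.B.W.finite_obj hXσ i
    have hdR := finrank_gradedPiece_add_finrank (P.dR.fil (X := X) i) p
      (P.dR.antitone_fil X i (le_add_of_nonneg_right zero_le_one))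
    have hB := (P.B.hodge hXσ i).finrank_F_eq_finrank_F_add_one_add_hodgeNumber hpq
    rw [P.finrank_fil_eq_finrank_F σ hX hXσ i p, P.finrank_fil_eq_finrank_F σ hX hXσ i (p + 1),
      hB] at hdR
    have hgr : P.dR.hodgeNumber X i p q = Module.finrank k (P.dR.gr X i p) := by
      simp [DeRhamRealization.hodgeNumber, hpq]
    rw [hgr]
    change Module.finrank k (gradedPiece (P.dR.fil (X := X) i) p) = _
    omega
  · rw [P.dR.hodgeNumber_of_add_ne X i hpq,
      (P.B.hodge hXσ i).hodgeNumber_eq_zero_of_add_ne hpq]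

end Hodge

end Literature.AlgebraicGeometry.Motives

end
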